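import Literature.Geometry.DiscreteGeometry.DihedralAngleFraction
import HarnessLib

/-!
# Girard's theorem for the normalised solid angle: `sol/4π = (dih₀ + dih₁ + dih₂ − π)/4π`
# — proved

Topic `Literature/Geometry/DiscreteGeometry`; third brick on solid angles after
`SphericalWedgeVolume.lean` (a wedge takes the fraction `θ/2π` of the ball) and
`DihedralAngleFraction.lean` (`dihedralFraction = dih/2π`).  `SolidAngleFraction.lean` defines,
for the route `AtomisticToContinuum/…/ReggeStarBounds`, the normalised solid angle
`solidAngleFraction v u` of the cone with apex `v` spanned by `u 0, u 1, u 2` as the fraction of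
the unit ball at `v` inside `apexCone v u` (Hales 2012, §3.2: `sol(C) = 3 vol(C ∩ B(v,1))`), and
lists Girard's formula `sol = dih₁ + dih₂ + dih₃ − π` (Hales, *Dense Sphere Packings*,
Lemma 3.23) as wanted.  This file proves it.

## The argument (no integration)

Let `H₀, H₁, H₂` be the three closed facet half-spaces of the cone `C = H₀ ∩ H₁ ∩ H₂` (inward
normals `mᵢ = triNormal …`, the component of `u i` orthogonal to the span of the other two;
`apexCone_eq_inter₃`), and `Wₖ = Hᵢ ∩ Hⱼ` the three dihedral wedges.  Any two `Wₖ` meet in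
`C`, so by inclusion–exclusion `Σₖ vol(Wₖ ∩ B) = vol(U ∩ B) + 2 vol(C ∩ B)` with
`U = W₀ ∪ W₁ ∪ W₂ = {x | at least two of the ⟪mᵢ, x⟫ are ≥ 0}`; `U` and `−U` cover the space and
overlap in the three null planes, so `vol(U ∩ B) = vol B / 2` (`volume_inter_ball_eq_half_of_symm`,
`volume_three_wedges`, `ballFraction_three_wedges`).  With `vol(Wₖ ∩ B) = (dihₖ/2π) vol B`
(`SphericalWedgeVolume`, `DihedralAngleFraction`: the wedge normals are the facet normals, up to
the symmetry `triNormal_comm`) this is Girard's formula: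
**`solidAngleFraction_eq_girard`** —
`solidAngleFraction v u = (dih₀ + dih₁ + dih₂ − π)/(4π)`,
`dihₖ = ∠(perpTo (u k) (u i), perpTo (u k) (u j))`, for linearly independent `u`; equivalently
**`solidAngleFraction_eq_dihedralFraction`** —
`solidAngleFraction v u = (Σₖ dihedralFraction v (v + u k) (the other two))/2 − 1/4`; and
`pi_le_sum_dihedral` (the spherical excess is `≥ 0`).

Everything is a definition (`triNormal`) or PROVED; no named facts.

## References

* T. C. Hales, *Dense Sphere Packings: a blueprint for formal proofs*, CUP 2012, Lemma 3.23
  (`sol = dih₁ + dih₂ + dih₃ − π`) and §3.2. [`HalesDSP2012`]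
* A. Girard, *Invention nouvelle en l'algèbre* (1629): the area of a spherical triangle is its
  excess. [folklore]
-/

noncomputable section

namespace Literature.Geometry.DiscreteGeometry

open Real RealInnerProductSpace MeasureTheory Metric Set

/-! ### Part T. The component of a vector orthogonal to the span of two others -/

section TriNormal

variable {F : Type*} [NormedAddCommGroup F] [InnerProductSpace ℝ F]

/-- The component of `a` orthogonal to `span {b, c}` (Gram–Schmidt: first orthogonalise against
`b`, then against `perpTo b c`): the inward normal of the facet `cone(b, c)` of the trihedral
cone `cone(a, b, c)`. [folklore] -/
def triNormal (a b c : F) : F := perpTo (perpTo b c) (perpTo b a)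

/-- Unfolding `triNormal`. [folklore] -/
theorem triNormal_def (a b c : F) : triNormal a b c = perpTo (perpTo b c) (perpTo b a) := rfl

/-- `triNormal a b c ⊥ b`. [folklore] -/
theorem inner_triNormal_fst (a b c : F) : ⟪b, triNormal a b c⟫ = 0 := by
  rw [triNormal, perpTo_def (perpTo b c), inner_sub_right, real_inner_smul_right,
    inner_left_perpTo, inner_left_perpTo, mul_zero, sub_zero]

/-- `triNormal a b c ⊥ c`. [folklore] -/
theorem inner_triNormal_snd (a b c : F) : ⟪c, triNormal a b c⟫ = 0 := by
  have h1 : ⟪perpTo b c, triNormal a b c⟫ = 0 := inner_left_perpTo _ _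
  have h2 := inner_triNormal_fst a b c
  have key : ⟪perpTo b c + (⟪b, c⟫ / ⟪b, b⟫) • b, triNormal a b c⟫ = 0 := by
    rw [inner_add_left, real_inner_smul_left, h1, h2, mul_zero, add_zero]
  rwa [perpTo_add_smul] at key

/-- `triNormal a b c = a − β b − κ c` for some scalars. [folklore] -/
theorem exists_triNormal_eq (a b c : F) : ∃ β κ : ℝ, triNormal a b c = a - β • b - κ • c := by
  refine ⟨⟪b, a⟫ / ⟪b, b⟫ - ⟪perpTo b c, perpTo b a⟫ / ⟪perpTo b c, perpTo b c⟫ * (⟪b, c⟫ / ⟪b, b⟫),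
    ⟪perpTo b c, perpTo b a⟫ / ⟪perpTo b c, perpTo b c⟫, ?_⟩
  simp only [triNormal, perpTo]
  module

/-- `⟪triNormal a b c, a⟫ = ‖triNormal a b c‖²`. [folklore] -/
theorem inner_triNormal_self (a b c : F) :
    ⟪triNormal a b c, a⟫ = ⟪triNormal a b c, triNormal a b c⟫ := by
  obtain ⟨β, κ, h⟩ := exists_triNormal_eq a b c
  have hb := inner_triNormal_fst a b c
  have hc := inner_triNormal_snd a b c
  rw [real_inner_comm] at hb hc
  calc ⟪triNormal a b c, a⟫
      = ⟪triNormal a b c, a⟫ - β * ⟪triNormal a b c, b⟫ - κ * ⟪triNormal a b c, c⟫ := by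
        rw [hb, hc]; ring
    _ = ⟪triNormal a b c, a - β • b - κ • c⟫ := by
        rw [inner_sub_right, inner_sub_right, real_inner_smul_right, real_inner_smul_right]
    _ = ⟪triNormal a b c, triNormal a b c⟫ := by rw [← h]

/-- **Uniqueness of the orthogonal component**: two vectors of the form `a − β b − κ c`, both
orthogonal to `b` and `c`, are equal (their difference lies in `span {b, c}` and is orthogonal to
it). [folklore] -/
theorem eq_of_orthogonal_of_sub_mem {a b c y y' : F} {β κ β' κ' : ℝ} (hy : y = a - β • b - κ • c)
    (hy' : y' = a - β' • b - κ' • c) (hyb : ⟪b, y⟫ = 0) (hyc : ⟪c, y⟫ = 0) (hy'b : ⟪b, y'⟫ = 0)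
    (hy'c : ⟪c, y'⟫ = 0) : y = y' := by
  have hδ : y - y' = (β' - β) • b + (κ' - κ) • c := by rw [hy, hy']; module
  have hbδ : ⟪b, y - y'⟫ = 0 := by rw [inner_sub_right, hyb, hy'b, sub_zero]
  have hcδ : ⟪c, y - y'⟫ = 0 := by rw [inner_sub_right, hyc, hy'c, sub_zero]
  have h0 : ⟪(β' - β) • b + (κ' - κ) • c, y - y'⟫ = 0 := by
    rw [inner_add_left, real_inner_smul_left, real_inner_smul_left, hbδ, hcδ]; ring
  rw [← hδ] at h0
  exact sub_eq_zero.1 (inner_self_eq_zero.1 h0)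

/-- **Symmetry**: the orthogonal component does not depend on the order of `b, c`.
[folklore] -/
theorem triNormal_comm (a b c : F) : triNormal a b c = triNormal a c b := by
  obtain ⟨β, κ, h⟩ := exists_triNormal_eq a b c
  obtain ⟨β', κ', h'⟩ := exists_triNormal_eq a c b
  have h'' : triNormal a c b = a - κ' • b - β' • c := by rw [h']; abel
  exact eq_of_orthogonal_of_sub_mem h h'' (inner_triNormal_fst a b c) (inner_triNormal_snd a b c)
    (inner_triNormal_snd a c b) (inner_triNormal_fst a c b)

/-- For a linearly independent triple, `triNormal a b c ≠ 0`. [folklore] -/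
theorem triNormal_ne_zero {a b c : F} (h : LinearIndependent ℝ ![a, b, c]) :
    triNormal a b c ≠ 0 := by
  obtain ⟨β, κ, he⟩ := exists_triNormal_eq a b c
  intro h0
  rw [h0] at he
  have := Fintype.linearIndependent_iff.1 h ![1, -β, -κ] (by
    simp [Fin.sum_univ_three]
    rw [eq_comm, sub_sub, sub_eq_zero] at he
    rw [he]; abel)
  simpa using this 0

end TriNormal

/-! ### Part V. Three half-spaces through the centre: an inclusion–exclusion identity -/

section ThreeHalfspaces

variable {E : Type*} [NormedAddCommGroup E] [InnerProductSpace ℝ E] [FiniteDimensional ℝ E]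
  [MeasurableSpace E] [BorelSpace E]

/-- **A set and its reflection through the centre that together cover the space and overlap in
a null set each take half of the ball.** [folklore] -/
theorem volume_inter_ball_eq_half_of_symm {U : Set E} (hU : MeasurableSet U)
    (hcov : ∀ x, x ∈ U ∨ -x ∈ U) (hnull : volume {x | x ∈ U ∧ -x ∈ U} = 0) :
    volume (U ∩ ball 0 1) = volume (ball (0 : E) 1) / 2 := by
  set U' : Set E := {x | -x ∈ U} with hU'
  have hmeas' : MeasurableSet U' := hU.preimage measurable_neg
  have hsymm : volume (U' ∩ ball 0 1) = volume (U ∩ ball 0 1) := by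
    have hpre : (LinearIsometryEquiv.neg ℝ : E ≃ₗᵢ[ℝ] E) ⁻¹' (U ∩ ball 0 1) = U' ∩ ball 0 1 := by
      ext x
      simp [hU', mem_ball, dist_zero_right]
    rw [← hpre]
    exact (LinearIsometryEquiv.neg ℝ (E := E)).measurePreserving.measure_preimage
      (hU.inter measurableSet_ball).nullMeasurableSet
  have hunion : U ∩ ball 0 1 ∪ U' ∩ ball 0 1 = ball 0 1 := by
    rw [← union_inter_distrib_right]
    refine inter_eq_self_of_subset_right fun x _ => ?_
    simpa [hU'] using hcov x
  have hinter : volume (U ∩ ball 0 1 ∩ (U' ∩ ball 0 1)) = 0 := by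
    refine measure_mono_null (fun x hx => ?_) hnull
    exact ⟨hx.1.1, hx.2.1⟩
  have hadd := measure_union_add_inter (μ := volume) (U ∩ ball 0 1)
    (t := U' ∩ ball (0 : E) 1) (hmeas'.inter measurableSet_ball)
  rw [hunion, hinter, add_zero, hsymm] at hadd
  rw [hadd, ENNReal.add_div, ENNReal.add_halves]

omit [FiniteDimensional ℝ E] in
/-- Closed half-spaces are measurable. [folklore] -/
theorem measurableSet_halfspace (m : E) : MeasurableSet {x : E | 0 ≤ ⟪m, x⟫} :=
  (isClosed_le continuous_const (by fun_prop)).measurableSet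

/-- **Inclusion–exclusion for the three dihedral wedges of a trihedral cone.**  For three closed
half-spaces `Hᵢ = {⟪mᵢ, ·⟫ ≥ 0}` through the centre (`mᵢ ≠ 0`), with `Wₖ = Hᵢ ∩ Hⱼ`
(`{i, j, k} = {0, 1, 2}`) and `C = H₀ ∩ H₁ ∩ H₂`:
`vol(W₀ ∩ B) + vol(W₁ ∩ B) + vol(W₂ ∩ B) = vol B / 2 + 2 vol(C ∩ B)` — the union
`W₀ ∪ W₁ ∪ W₂ = {at least two of the ⟪mᵢ, x⟫ are ≥ 0}` and its reflection cover the space and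
meet in the three null planes, and any two of the `Wₖ` meet in `C`. [folklore] -/
theorem volume_three_wedges {m₀ m₁ m₂ : E} (h₀ : m₀ ≠ 0) (h₁ : m₁ ≠ 0) (h₂ : m₂ ≠ 0) :
    volume ({x : E | 0 ≤ ⟪m₁, x⟫} ∩ {x | 0 ≤ ⟪m₂, x⟫} ∩ ball 0 1) +
      volume ({x : E | 0 ≤ ⟪m₀, x⟫} ∩ {x | 0 ≤ ⟪m₂, x⟫} ∩ ball 0 1) +
      volume ({x : E | 0 ≤ ⟪m₀, x⟫} ∩ {x | 0 ≤ ⟪m₁, x⟫} ∩ ball 0 1) =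
    volume (ball (0 : E) 1) / 2 +
      2 * volume ({x : E | 0 ≤ ⟪m₀, x⟫} ∩ {x | 0 ≤ ⟪m₁, x⟫} ∩ {x | 0 ≤ ⟪m₂, x⟫} ∩ ball 0 1) := by
  set H₀ : Set E := {x | 0 ≤ ⟪m₀, x⟫} with hH₀
  set H₁ : Set E := {x | 0 ≤ ⟪m₁, x⟫} with hH₁
  set H₂ : Set E := {x | 0 ≤ ⟪m₂, x⟫} with hH₂
  have hmH₀ : MeasurableSet H₀ := measurableSet_halfspace m₀
  have hmH₁ : MeasurableSet H₁ := measurableSet_halfspace m₁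
  have hmH₂ : MeasurableSet H₂ := measurableSet_halfspace m₂
  set B : Set E := ball 0 1 with hB
  have hmB : MeasurableSet B := measurableSet_ball
  set X₀ := H₁ ∩ H₂ ∩ B with hX₀
  set X₁ := H₀ ∩ H₂ ∩ B with hX₁
  set X₂ := H₀ ∩ H₁ ∩ B with hX₂
  set XC := H₀ ∩ H₁ ∩ H₂ ∩ B with hXC
  -- first inclusion–exclusion
  have h01 : X₀ ∩ X₁ = XC := by
    ext x; simp only [hX₀, hX₁, hXC, mem_inter_iff]; tauto
  have hie1 := measure_union_add_inter (μ := volume) X₀ (t := X₁) ((hmH₀.inter hmH₂).inter hmB)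
  rw [h01] at hie1
  -- second inclusion–exclusion
  have h012 : (X₀ ∪ X₁) ∩ X₂ = XC := by
    ext x; simp only [hX₀, hX₁, hX₂, hXC, mem_inter_iff, mem_union]; tauto
  have hie2 := measure_union_add_inter (μ := volume) (X₀ ∪ X₁) (t := X₂)
    ((hmH₀.inter hmH₁).inter hmB)
  rw [h012] at hie2
  -- the union takes half of the ball
  set U : Set E := H₁ ∩ H₂ ∪ H₀ ∩ H₂ ∪ H₀ ∩ H₁ with hUdef
  have hUeq : X₀ ∪ X₁ ∪ X₂ = U ∩ B := by
    simp only [hX₀, hX₁, hX₂, hUdef, union_inter_distrib_right]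
  have hmU : MeasurableSet U :=
    ((hmH₁.inter hmH₂).union (hmH₀.inter hmH₂)).union (hmH₀.inter hmH₁)
  have hcov : ∀ x, x ∈ U ∨ -x ∈ U := by
    intro x
    simp only [hUdef, hH₀, hH₁, hH₂, mem_union, mem_inter_iff, mem_setOf_eq, inner_neg_right,
      neg_nonneg]
    rcases le_total 0 ⟪m₀, x⟫ with a | a <;> rcases le_total 0 ⟪m₁, x⟫ with b | b <;>
      rcases le_total 0 ⟪m₂, x⟫ with c | c <;> tauto
  have hnull : volume {x | x ∈ U ∧ -x ∈ U} = 0 := by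
    have hplanes : volume ({x : E | ⟪m₀, x⟫ = 0} ∪ {x | ⟪m₁, x⟫ = 0} ∪ {x | ⟪m₂, x⟫ = 0}) = 0 := by
      refine measure_union_null (measure_union_null ?_ ?_) ?_ <;>
        exact volume_inner_eq_zero ‹_›
    refine measure_mono_null (fun x hx => ?_) hplanes
    simp only [hUdef, hH₀, hH₁, hH₂, mem_union, mem_inter_iff, mem_setOf_eq, inner_neg_right,
      neg_nonneg] at hx ⊢
    obtain ⟨hx1, hx2⟩ := hx
    rcases hx1 with (⟨b, c⟩ | ⟨a, c⟩) | ⟨a, b⟩ <;>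
      rcases hx2 with (⟨b', c'⟩ | ⟨a', c'⟩) | ⟨a', b'⟩
    all_goals first
      | exact Or.inl (Or.inl (le_antisymm ‹⟪m₀, x⟫ ≤ 0› ‹0 ≤ ⟪m₀, x⟫›))
      | exact Or.inl (Or.inr (le_antisymm ‹⟪m₁, x⟫ ≤ 0› ‹0 ≤ ⟪m₁, x⟫›))
      | exact Or.inr (le_antisymm ‹⟪m₂, x⟫ ≤ 0› ‹0 ≤ ⟪m₂, x⟫›)
  have hhalf := volume_inter_ball_eq_half_of_symm hmU hcov hnull
  rw [← hUeq] at hhalf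
  -- assemble: vol X₀ + vol X₁ + vol X₂ = vol(X₀ ∪ X₁ ∪ X₂) + 2 vol XC
  calc volume X₀ + volume X₁ + volume X₂
      = (volume (X₀ ∪ X₁) + volume XC) + volume X₂ := by rw [hie1]
    _ = (volume (X₀ ∪ X₁) + volume X₂) + volume XC := by ring
    _ = (volume (X₀ ∪ X₁ ∪ X₂) + volume XC) + volume XC := by rw [hie2]
    _ = volume (ball (0 : E) 1) / 2 + 2 * volume XC := by rw [hhalf, two_mul]; ring

/-- The same in terms of ball fractions (real numbers). [folklore] -/
theorem ballFraction_three_wedges [Nontrivial E] {m₀ m₁ m₂ : E} (h₀ : m₀ ≠ 0) (h₁ : m₁ ≠ 0)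
    (h₂ : m₂ ≠ 0) :
    ballFraction (0 : E) ({x : E | 0 ≤ ⟪m₁, x⟫} ∩ {x | 0 ≤ ⟪m₂, x⟫}) +
      ballFraction (0 : E) ({x : E | 0 ≤ ⟪m₀, x⟫} ∩ {x | 0 ≤ ⟪m₂, x⟫}) +
      ballFraction (0 : E) ({x : E | 0 ≤ ⟪m₀, x⟫} ∩ {x | 0 ≤ ⟪m₁, x⟫}) =
    1 / 2 + 2 * ballFraction (0 : E)
      ({x : E | 0 ≤ ⟪m₀, x⟫} ∩ {x | 0 ≤ ⟪m₁, x⟫} ∩ {x | 0 ≤ ⟪m₂, x⟫}) := by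
  have h := volume_three_wedges h₀ h₁ h₂
  simp only [ballFraction]
  have hV := volume_ball_toReal_pos (E := E)
  have hVtop : volume (ball (0 : E) 1) ≠ ⊤ := measure_ball_lt_top.ne
  have hfin : ∀ S : Set E, volume (ball (0 : E) 1 ∩ S) ≠ ⊤ := fun S =>
    (measure_lt_top_of_subset inter_subset_left hVtop).ne
  -- rewrite `S ∩ ball` as `ball ∩ S` in `h`
  simp only [inter_comm _ (ball (0 : E) 1)] at h
  simp only [← inter_assoc] at h ⊢
  -- name the real numbers
  set X₀ := volume (ball (0 : E) 1 ∩ {x : E | 0 ≤ ⟪m₁, x⟫} ∩ {x | 0 ≤ ⟪m₂, x⟫}) with hX₀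
  set X₁ := volume (ball (0 : E) 1 ∩ {x : E | 0 ≤ ⟪m₀, x⟫} ∩ {x | 0 ≤ ⟪m₂, x⟫}) with hX₁
  set X₂ := volume (ball (0 : E) 1 ∩ {x : E | 0 ≤ ⟪m₀, x⟫} ∩ {x | 0 ≤ ⟪m₁, x⟫}) with hX₂
  set XC := volume (ball (0 : E) 1 ∩ {x : E | 0 ≤ ⟪m₀, x⟫} ∩ {x | 0 ≤ ⟪m₁, x⟫} ∩
    {x | 0 ≤ ⟪m₂, x⟫}) with hXC
  set V := volume (ball (0 : E) 1) with hVdef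
  have hX₀t : X₀ ≠ ⊤ := by rw [hX₀, inter_assoc]; exact hfin _
  have hX₁t : X₁ ≠ ⊤ := by rw [hX₁, inter_assoc]; exact hfin _
  have hX₂t : X₂ ≠ ⊤ := by rw [hX₂, inter_assoc]; exact hfin _
  have hXCt : XC ≠ ⊤ := by rw [hXC, inter_assoc, inter_assoc]; exact hfin _
  have e := congrArg ENNReal.toReal h
  have l1 : (X₀ + X₁ + X₂).toReal = X₀.toReal + X₁.toReal + X₂.toReal := by
    rw [ENNReal.toReal_add (ENNReal.add_ne_top.2 ⟨hX₀t, hX₁t⟩) hX₂t, ENNReal.toReal_add hX₀t hX₁t]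
  have r1 : (V / 2 + 2 * XC).toReal = V.toReal / 2 + 2 * XC.toReal := by
    rw [ENNReal.toReal_add (ne_top_of_le_ne_top hVtop ENNReal.half_le_self)
      (ENNReal.mul_ne_top (by simp) hXCt), ENNReal.toReal_div, ENNReal.toReal_mul]
    norm_num
  rw [l1, r1] at e
  field_simp
  rw [e]
  ring

end ThreeHalfspaces

/-! ### Part G. The trihedral cone and Girard's theorem -/

section Girard

open InnerProductGeometry Finset

variable {E : Type*} [NormedAddCommGroup E] [InnerProductSpace ℝ E] [FiniteDimensional ℝ E]
  [MeasurableSpace E] [BorelSpace E]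

/-- **Translation invariance of ball fractions**: the fraction of the unit ball at `v` inside
`{x | x − v ∈ S}` is the fraction of the unit ball at `0` inside `S`. [folklore] -/
theorem ballFraction_setOf_sub_mem (v : E) (S : Set E) :
    ballFraction v {x | x - v ∈ S} = ballFraction 0 S := by
  rw [ballFraction, ballFraction]
  have hball : ball v 1 = (fun x => x + -v) ⁻¹' ball (0 : E) 1 := by
    ext x; simp [mem_ball, dist_eq_norm, ← sub_eq_add_neg]
  have hset : ball v 1 ∩ {x | x - v ∈ S} = (fun x => x + -v) ⁻¹' (ball (0 : E) 1 ∩ S) := by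
    rw [hball]; ext x; simp [sub_eq_add_neg]
  rw [hset, hball, measure_preimage_add_right, measure_preimage_add_right]

local notation "E3" => EuclideanSpace ℝ (Fin 3)

/-- Re-indexing a linearly independent triple. [folklore] -/
theorem linearIndependent_triple_perm {u : Fin 3 → E3} (hli : LinearIndependent ℝ u)
    (i j k : Fin 3) (hij : i ≠ j) (hik : i ≠ k) (hjk : j ≠ k) :
    LinearIndependent ℝ ![u i, u j, u k] := by
  have hinj : Function.Injective ![i, j, k] := by
    intro a b hab
    fin_cases a <;> fin_cases b <;> simp_all [eq_comm]
  convert hli.comp ![i, j, k] hinj using 1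
  ext a : 1
  fin_cases a <;> rfl

variable (v : E3) (u : Fin 3 → E3)

/-- **A nondegenerate trihedral cone is the intersection of three closed half-spaces**, with
inward facet normals `m₀ = triNormal (u 0) (u 1) (u 2)` (normal to the facet `cone(u 1, u 2)`,
on the side of `u 0`), `m₁ = triNormal (u 1) (u 0) (u 2)`, `m₂ = triNormal (u 2) (u 0) (u 1)`.
[folklore] -/
theorem apexCone_eq_inter₃ (hli : LinearIndependent ℝ u) :
    apexCone v u =
      {x | 0 ≤ ⟪triNormal (u 0) (u 1) (u 2), x - v⟫} ∩
        {x | 0 ≤ ⟪triNormal (u 1) (u 0) (u 2), x - v⟫} ∩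
        {x | 0 ≤ ⟪triNormal (u 2) (u 0) (u 1), x - v⟫} := by
  set m₀ := triNormal (u 0) (u 1) (u 2) with hm₀
  set m₁ := triNormal (u 1) (u 0) (u 2) with hm₁
  set m₂ := triNormal (u 2) (u 0) (u 1) with hm₂
  have h012 := linearIndependent_triple_perm hli 0 1 2 (by decide) (by decide) (by decide)
  have h102 := linearIndependent_triple_perm hli 1 0 2 (by decide) (by decide) (by decide)
  have h201 := linearIndependent_triple_perm hli 2 0 1 (by decide) (by decide) (by decide)
  -- orthogonality relations
  have h01 : ⟪m₀, u 1⟫ = 0 := by rw [real_inner_comm]; exact inner_triNormal_fst _ _ _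
  have h02 : ⟪m₀, u 2⟫ = 0 := by rw [real_inner_comm]; exact inner_triNormal_snd _ _ _
  have h10 : ⟪m₁, u 0⟫ = 0 := by rw [real_inner_comm]; exact inner_triNormal_fst _ _ _
  have h12 : ⟪m₁, u 2⟫ = 0 := by rw [real_inner_comm]; exact inner_triNormal_snd _ _ _
  have h20 : ⟪m₂, u 0⟫ = 0 := by rw [real_inner_comm]; exact inner_triNormal_fst _ _ _
  have h21 : ⟪m₂, u 1⟫ = 0 := by rw [real_inner_comm]; exact inner_triNormal_snd _ _ _
  have h00 : ⟪m₀, u 0⟫ = ⟪m₀, m₀⟫ := inner_triNormal_self _ _ _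
  have h11 : ⟪m₁, u 1⟫ = ⟪m₁, m₁⟫ := inner_triNormal_self _ _ _
  have h22 : ⟪m₂, u 2⟫ = ⟪m₂, m₂⟫ := inner_triNormal_self _ _ _
  have hp0 : 0 < ⟪m₀, m₀⟫ := real_inner_self_pos.2 (triNormal_ne_zero h012)
  have hp1 : 0 < ⟪m₁, m₁⟫ := real_inner_self_pos.2 (triNormal_ne_zero h102)
  have hp2 : 0 < ⟪m₂, m₂⟫ := real_inner_self_pos.2 (triNormal_ne_zero h201)
  ext x
  simp only [apexCone, Set.mem_setOf_eq, Set.mem_inter_iff, Fin.sum_univ_three]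
  constructor
  · rintro ⟨c, hc, rfl⟩
    have e : v + (c 0 • u 0 + c 1 • u 1 + c 2 • u 2) - v = c 0 • u 0 + c 1 • u 1 + c 2 • u 2 := by
      abel
    rw [e]
    simp only [inner_add_right, real_inner_smul_right, h01, h02, h10, h12, h20, h21, h00, h11,
      h22, mul_zero, zero_add, add_zero]
    exact ⟨⟨mul_nonneg (hc 0) hp0.le, mul_nonneg (hc 1) hp1.le⟩, mul_nonneg (hc 2) hp2.le⟩
  · rintro ⟨⟨hx0, hx1⟩, hx2⟩
    have hcard : Fintype.card (Fin 3) = Module.finrank ℝ E3 := by simp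
    set B := basisOfLinearIndependentOfCardEqFinrank hli hcard with hB
    have hBv : ∀ i, B i = u i := fun i => by
      rw [hB, coe_basisOfLinearIndependentOfCardEqFinrank]
    have hx : x - v = B.repr (x - v) 0 • u 0 + B.repr (x - v) 1 • u 1 + B.repr (x - v) 2 • u 2 := by
      conv_lhs => rw [← B.sum_repr (x - v)]
      simp only [Fin.sum_univ_three, hBv]
    set c₀ := B.repr (x - v) 0
    set c₁ := B.repr (x - v) 1
    set c₂ := B.repr (x - v) 2
    rw [hx] at hx0 hx1 hx2
    simp only [inner_add_right, real_inner_smul_right, h01, h02, h10, h12, h20, h21, h00, h11,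
      h22, mul_zero, zero_add, add_zero] at hx0 hx1 hx2
    refine ⟨![c₀, c₁, c₂], fun i => ?_, ?_⟩
    · fin_cases i
      · exact nonneg_of_mul_nonneg_left hx0 hp0
      · exact nonneg_of_mul_nonneg_left hx1 hp1
      · exact nonneg_of_mul_nonneg_left hx2 hp2
    · have : x = v + (x - v) := by abel
      rw [this, hx]
      simp [add_assoc]

/-- **Girard's theorem for the normalised solid angle** (Hales 2012, Lemma 3.23 / §8.6.2:
`sol = dih₁ + dih₂ + dih₃ − π`).  For a nondegenerate trihedral cone with apex `v` spanned by
`u 0, u 1, u 2`, the fraction of the unit ball at `v` inside the cone is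
`(dih₀ + dih₁ + dih₂ − π) / 4π`, where `dihₖ = ∠(perpTo (u k) (u i), perpTo (u k) (u j))` is the
dihedral angle along the edge `u k`.  Proof: the cone is the intersection of the three facet
half-spaces (`apexCone_eq_inter₃`); the three dihedral wedges satisfy the inclusion–exclusion
identity `Σ f(Wₖ) = ½ + 2 f(C)` (`ballFraction_three_wedges`: their union and its reflection
cover the ball, overlapping in null planes); and `f(Wₖ) = dihₖ / 2π`
(`ballFraction_halfspace_inter_halfspace`, `angle_perpTo_perpTo`).
[cite: HalesDSP2012, Lemma 3.23 and §3.2] -/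
theorem solidAngleFraction_eq_girard (hli : LinearIndependent ℝ u) :
    solidAngleFraction v u =
      (angle (perpTo (u 0) (u 1)) (perpTo (u 0) (u 2)) +
        angle (perpTo (u 1) (u 0)) (perpTo (u 1) (u 2)) +
        angle (perpTo (u 2) (u 0)) (perpTo (u 2) (u 1)) - π) / (4 * π) := by
  set m₀ := triNormal (u 0) (u 1) (u 2) with hm₀
  set m₁ := triNormal (u 1) (u 0) (u 2) with hm₁
  set m₂ := triNormal (u 2) (u 0) (u 1) with hm₂
  have h012 := linearIndependent_triple_perm hli 0 1 2 (by decide) (by decide) (by decide)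
  have h102 := linearIndependent_triple_perm hli 1 0 2 (by decide) (by decide) (by decide)
  have h201 := linearIndependent_triple_perm hli 2 0 1 (by decide) (by decide) (by decide)
  have hm₀0 : m₀ ≠ 0 := triNormal_ne_zero h012
  have hm₁0 : m₁ ≠ 0 := triNormal_ne_zero h102
  have hm₂0 : m₂ ≠ 0 := triNormal_ne_zero h201
  -- the three planar pairs
  have hab0 : LinearIndependent ℝ ![perpTo (u 0) (u 1), perpTo (u 0) (u 2)] :=
    linearIndependent_perpTo_pair h012
  have hab1 : LinearIndependent ℝ ![perpTo (u 1) (u 0), perpTo (u 1) (u 2)] :=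
    linearIndependent_perpTo_pair h102
  have hab2 : LinearIndependent ℝ ![perpTo (u 2) (u 0), perpTo (u 2) (u 1)] :=
    linearIndependent_perpTo_pair h201
  -- the wedge normals are the facet normals
  have e0a : perpTo (perpTo (u 0) (u 1)) (perpTo (u 0) (u 2)) = m₂ := rfl
  have e0b : perpTo (perpTo (u 0) (u 2)) (perpTo (u 0) (u 1)) = m₁ := rfl
  have e1a : perpTo (perpTo (u 1) (u 0)) (perpTo (u 1) (u 2)) = m₂ :=
    triNormal_comm (u 2) (u 1) (u 0)
  have e1b : perpTo (perpTo (u 1) (u 2)) (perpTo (u 1) (u 0)) = m₀ := rfl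
  have e2a : perpTo (perpTo (u 2) (u 0)) (perpTo (u 2) (u 1)) = m₁ :=
    triNormal_comm (u 1) (u 2) (u 0)
  have e2b : perpTo (perpTo (u 2) (u 1)) (perpTo (u 2) (u 0)) = m₀ :=
    triNormal_comm (u 0) (u 2) (u 1)
  -- the three dihedral wedges as ball fractions
  have hW0 : ballFraction (0 : E3) ({x | 0 ≤ ⟪m₁, x⟫} ∩ {x | 0 ≤ ⟪m₂, x⟫}) =
      angle (perpTo (u 0) (u 1)) (perpTo (u 0) (u 2)) / (2 * π) := by
    have hind := linearIndependent_perpTo_perpTo hab0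
    rw [e0a, e0b] at hind
    have hang := angle_perpTo_perpTo hab0
    rw [e0a, e0b] at hang
    rw [ballFraction_halfspace_inter_halfspace (linearIndependent_pair_swap hind), angle_comm,
      hang, sub_sub_cancel]
  have hW1 : ballFraction (0 : E3) ({x | 0 ≤ ⟪m₀, x⟫} ∩ {x | 0 ≤ ⟪m₂, x⟫}) =
      angle (perpTo (u 1) (u 0)) (perpTo (u 1) (u 2)) / (2 * π) := by
    have hind := linearIndependent_perpTo_perpTo hab1
    rw [e1a, e1b] at hind
    have hang := angle_perpTo_perpTo hab1
    rw [e1a, e1b] at hang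
    rw [ballFraction_halfspace_inter_halfspace (linearIndependent_pair_swap hind), angle_comm,
      hang, sub_sub_cancel]
  have hW2 : ballFraction (0 : E3) ({x | 0 ≤ ⟪m₀, x⟫} ∩ {x | 0 ≤ ⟪m₁, x⟫}) =
      angle (perpTo (u 2) (u 0)) (perpTo (u 2) (u 1)) / (2 * π) := by
    have hind := linearIndependent_perpTo_perpTo hab2
    rw [e2a, e2b] at hind
    have hang := angle_perpTo_perpTo hab2
    rw [e2a, e2b] at hang
    rw [ballFraction_halfspace_inter_halfspace (linearIndependent_pair_swap hind), angle_comm,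
      hang, sub_sub_cancel]
  -- inclusion–exclusion
  have hie := ballFraction_three_wedges hm₀0 hm₁0 hm₂0
  rw [hW0, hW1, hW2] at hie
  -- the cone, translated to the centre
  have hcone : solidAngleFraction v u =
      ballFraction (0 : E3) ({x | 0 ≤ ⟪m₀, x⟫} ∩ {x | 0 ≤ ⟪m₁, x⟫} ∩ {x | 0 ≤ ⟪m₂, x⟫}) := by
    rw [solidAngleFraction, apexCone_eq_inter₃ v u hli, ← ballFraction_setOf_sub_mem v]
    rfl
  rw [hcone]
  have hπ : 0 < π := Real.pi_pos
  have hf : ballFraction (0 : E3) ({x | 0 ≤ ⟪m₀, x⟫} ∩ {x | 0 ≤ ⟪m₁, x⟫} ∩ {x | 0 ≤ ⟪m₂, x⟫}) =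
      ((angle (perpTo (u 0) (u 1)) (perpTo (u 0) (u 2)) +
        angle (perpTo (u 1) (u 0)) (perpTo (u 1) (u 2)) +
        angle (perpTo (u 2) (u 0)) (perpTo (u 2) (u 1))) / (2 * π) - 1 / 2) / 2 := by
    rw [add_div, add_div]
    linarith [hie]
  rw [hf]
  field_simp
  ring

/-- **Girard's formula in the vocabulary of `SolidAngleFraction.lean`**: the normalised solid
angle is half the sum of the three normalised dihedral angles minus a quarter —
`sol/4π = (dih₀ + dih₁ + dih₂)/4π − 1/4`. [cite: HalesDSP2012, Lemma 3.23] -/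
theorem solidAngleFraction_eq_dihedralFraction (hli : LinearIndependent ℝ u) :
    solidAngleFraction v u =
      (dihedralFraction v (v + u 0) ![u 1, u 2] + dihedralFraction v (v + u 1) ![u 0, u 2]
        + dihedralFraction v (v + u 2) ![u 0, u 1]) / 2 - 1 / 4 := by
  have h012 := linearIndependent_triple_perm hli 0 1 2 (by decide) (by decide) (by decide)
  have h102 := linearIndependent_triple_perm hli 1 0 2 (by decide) (by decide) (by decide)
  have h201 := linearIndependent_triple_perm hli 2 0 1 (by decide) (by decide) (by decide)
  rw [dihedralFraction_eq_angle_div v (v + u 0) ![u 1, u 2] (by simpa using h012),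
    dihedralFraction_eq_angle_div v (v + u 1) ![u 0, u 2] (by simpa using h102),
    dihedralFraction_eq_angle_div v (v + u 2) ![u 0, u 1] (by simpa using h201),
    solidAngleFraction_eq_girard v u hli]
  simp only [add_sub_cancel_left, Matrix.cons_val_zero, Matrix.cons_val_one]
  have hπ : 0 < π := Real.pi_pos
  field_simp
  ring

/-- **The spherical excess is nonnegative**: `dih₀ + dih₁ + dih₂ ≥ π` for the dihedral angles of
a nondegenerate trihedral cone — from Girard's formula and `solidAngleFraction ≥ 0`.
[folklore] -/
theorem pi_le_sum_dihedral (hli : LinearIndependent ℝ u) :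
    π ≤ angle (perpTo (u 0) (u 1)) (perpTo (u 0) (u 2)) +
        angle (perpTo (u 1) (u 0)) (perpTo (u 1) (u 2)) +
        angle (perpTo (u 2) (u 0)) (perpTo (u 2) (u 1)) := by
  have h := solidAngleFraction_eq_girard 0 u hli
  have h0 : 0 ≤ solidAngleFraction 0 u := ballFraction_nonneg _ _
  rw [h] at h0
  have hπ : 0 < π := Real.pi_pos
  have := mul_nonneg h0 (by positivity : (0 : ℝ) ≤ 4 * π)
  rw [div_mul_cancel₀ _ (by positivity)] at this
  linarith

end Girard

end Literature.Geometry.DiscreteGeometry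

end
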